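import Summits.CriticalPhenomena.PercolationContinuityZ3.Theorems.PercNearOneGluingNoHeavyConstsClusterSquare
import HarnessLib

/-!
# The triple-split budget: TS needs the cluster square only up to `μ(b↮c)·μ(¬abc)`, so the quad-clash mass has a macroscopic budget

builds on p205010 (kernel theorem, internal audit signed; external expert review pending)

PAPER-2 track "percolation constants", part (ii), seat `prim-consts-1`, gen 18 (lane index
`run/shared/lean/prim/consts/CONSTANTS.md`, row A19; memo `FROM-prim-consts-1-g18-QUAD-CLASH.md` §2).
Support file for the crux `NoHeavyLowerTail` (stmt-CriticalPhenomena-4575; `--supports`).  One `Prop` definition (an OPEN statement,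
tagged `@[conjecture]`) and theorems; no sorries.  Nothing here claims the conjecture.

Notation (`μ = prodBernoulli w`, vertices `a, b, c`; connection patterns of `{a,b,c}`: `x = a|b|c`, `A = a|bc`, `B = b|ac`, `C = c|ab`,
`t = abc`): `s = μ(x)`, `D = μ(a↮b, a↮c) = x + A`, `U = μ(b↮c) = x + B + C`, `V = μ(¬abc) = μ(a↮b ∨ a↮c) = 1 − t`,
`U_ab = x + A + B`, `U_ac = x + A + C`, `T = Consts.clusterSquare w a b c`.

THE POINT.  The lane's route to the triple-split inequality TS (`Consts.TripleSplit`: `s² ≤ U_ab·U_ac·U`) is Cauchy–Schwarz over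
the cluster of `a`, `s² ≤ D·T` (`Consts.sq_real_split_le_real_mul_clusterSquare`), followed by the conjecture CSQ `T ≤ U²`.  But TS only
needs `D·T ≤ U_ab·U_ac·U` (`Consts.tripleSplit_of_mul_clusterSquare_le`), and since `U_ab·U_ac − D·U = B·C + A·D ≥ 0`, any bound
`T ≤ U·V` suffices (`Consts.tripleSplit_of_clusterSquare_le_mul_notAll`; `D·V ≤ U_ab·U_ac` is inclusion–exclusion).  This is typed as the
**CONJECTURE (CSQ-V) `Consts.ClusterSquareSplitV`**: `T ≤ μ(b↮c)·μ(¬abc)` — implied by CSQ (`clusterSquareSplitV_of_clusterSquareSplit`),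
implying TS (`tripleSplit_of_clusterSquareSplitV`), and with room `U·(V − U) = U·μ(a|bc)` beyond CSQ, which is large exactly on the dense
graphs where CSQ is delicate.  Combined with the two-copy bound `T ≤ U² + P(E ∩ {quadruple clash})`
(`Consts.setIntegral_sepOff_sq_le_sq_add_quadClash`) this turns TS at `(a; b, c)` into a BUDGET inequality for the quad-clash mass:
**`Consts.tripleSplit_of_clusterSquare_budget`: if `T ≤ U² + Q` and `D·(U² + Q) ≤ U_ab·U_ac·U` then TS holds for `{a, b, c}`**
— with `Q` the quad-clash mass it suffices that `D·P(E ∩ quad clash) ≤ U·(B·C + A·D)` (`…_budget'`).  Seat evidence (exact engines `eng/tsroom*.py`, `eng/census_rho.py`, `eng/glued.py`; kit j190540 pending at submission):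
the ratio `ρ = D·P(E ∩ quad clash)/(U(BC + AD))` is `≤ 0.0114` at uniform weights on every rooted graph with `≤ 6` vertices and `≤ 10`
edges (exact census; argmax `K₃,₃`), `≤ 0.033` under adversarial weight search on `W₄, K₅, K₅ − e, G₇` (argmax: `a` nearly isolated next
to a `4`-cycle `b–y–c–y'`, `ρ → max_β 2β²(1−β)²/((1+β)²(2−β²)) ≈ 0.0325`), about `0.105` in the family "apex over a subdivided `K_{2,m}`"
(`m → ∞`, by hand), and the classical Harris × van den Berg–Kesten bound on the glued double of `G − K` (`P(E ∩ quad clash at K) ≤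
p_K u_K² π_K²`, `π_K = P(b₁ ↔ c₂)` in two copies of `G − K` glued along `N(K) ∖ {b,c}`) stays below `0.3` of the budget on `K₅, K₅ − e,
W₄, G₇` at all weights tried.  The budget inequality itself is OPEN.
References: N. Gladkov, arXiv:2408.08457v2 (2024), Thm. 5.2 (Cauchy–Schwarz over the leaves), Thm. 4.3; G. Grimmett, *Percolation* (1999),
§2.2 (Harris), §2.3 (van den Berg–Kesten).
-/

noncomputable section

open Classical

namespace Summit.CriticalPhenomena.PercolationContinuityZ3.Theorems

open MeasureTheory Finset Literature.Probability.LatticeModels Literature.Probability.Percolation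
open Literature.Probability.Percolation.DecisionTree Literature.Probability.Percolation.BHK2006
open Literature.Probability.Percolation.TargetExploration Literature.Probability.Percolation.ClusterConditioning

namespace Consts

/-- **CONJECTURE (CSQ-V) — the cluster square against `μ(b↮c)·μ(¬abc)`.**  For every finite weighted graph and vertices `a, b, c`:
`∫_{a↮b, a↮c} μ{b ↮ c off C_a(ω)}² dμ(ω) ≤ μ(b ↮ c) · μ(¬(a ↔ b ∧ a ↔ c))`, i.e. `T ≤ U·V` with `V = 1 − μ(abc) ≥ U`.  OPEN (conjectured in
this programme, PAPER-2 consts track, seat prim-consts-1 gen 18, 2026-08-23).  It is implied by `Consts.ClusterSquareSplit` (CSQ, `T ≤ U²`,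
census-clean) and implies `Consts.TripleSplit` (`Consts.tripleSplit_of_clusterSquareSplitV`); unlike CSQ it leaves the room `U·μ(a|bc)`,
so that the two-copy quad-clash bound `T ≤ U² + P(E ∩ quad clash)` proves it whenever `P(E ∩ quad clash) ≤ U·μ(a|bc)` (seat evidence:
the quad-clash mass is `≤ 1.2 %` of the TS budget `U(BC+AD)/D ⊇ U·μ(a|bc)` on all rooted graphs with `≤ 6` vertices, `≤ 10` edges at
uniform weights, `≤ 3.3 %` under adversarial weights on `W₄, K₅, G₇`; `≈ 10 %` in the apex-over-subdivided-`K_{2,m}` family).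
builds on p205010 (kernel theorem, internal audit signed; external expert review pending).
[cite: Gladkov2024, Thm. 5.2 and Thm. 4.3 (the Cauchy–Schwarz + decision-tree vdBK pattern)] [status: open] -/
@[conjecture] def ClusterSquareSplitV : Prop :=
  ∀ (n : ℕ) (w : Sym2 (Fin n) → unitInterval) (a b c : Fin n),
    clusterSquare w a b c ≤ (prodBernoulli w).real (openConn b c)ᶜ * (prodBernoulli w).real (openConn a b ∩ openConn a c)ᶜ

/-- CSQ ⟹ CSQ-V: `U ≤ V` since `b ↮ c` forbids `a ↔ b ∧ a ↔ c`. [folklore] -/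
theorem clusterSquareSplitV_of_clusterSquareSplit (h : ClusterSquareSplit) : ClusterSquareSplitV := by
  intro n w a b c
  refine (h n w a b c).trans ?_
  rw [sq]
  refine mul_le_mul_of_nonneg_left (measureReal_mono (fun ω hω => ?_) (measure_ne_top _ _)) measureReal_nonneg
  intro hV
  exact hω (hV.1.symm.trans hV.2)

/-- **TS from `D·T ≤ U_ab·U_ac·U_bc`** (Cauchy–Schwarz over the cluster of `a`): `μ(a|b|c)² ≤ μ(a↮b)·μ(a↮c)·μ(b↮c)`.
[cite: Gladkov2024, Thm. 5.2] -/
theorem tripleSplit_of_mul_clusterSquare_le {n : ℕ} (w : Sym2 (Fin n) → unitInterval) (a b c : Fin n)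
    (h : (prodBernoulli w).real ((openConn a b)ᶜ ∩ (openConn a c)ᶜ) * clusterSquare w a b c ≤
      (prodBernoulli w).real (openConn a b)ᶜ * (prodBernoulli w).real (openConn a c)ᶜ * (prodBernoulli w).real (openConn b c)ᶜ) :
    (prodBernoulli w).real ((openConn a b)ᶜ ∩ (openConn a c)ᶜ ∩ (openConn b c)ᶜ) ^ 2 ≤
      (prodBernoulli w).real (openConn a b)ᶜ * (prodBernoulli w).real (openConn a c)ᶜ *
        (prodBernoulli w).real (openConn b c)ᶜ :=
  (sq_real_split_le_real_mul_clusterSquare w a b c).trans h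

/-- **TS from `T ≤ U·V`** (`V = μ(¬abc) = μ({a↮b} ∪ {a↮c})`): inclusion–exclusion `μ(D_a)·μ(V) ≤ μ(a↮b)·μ(a↮c)` turns `D·T ≤ D·U·V`
into `D·T ≤ U_ab·U_ac·U`. [cite: Gladkov2024, Thm. 5.2 (pattern)] -/
theorem tripleSplit_of_clusterSquare_le_mul_notAll {n : ℕ} (w : Sym2 (Fin n) → unitInterval) (a b c : Fin n)
    (h : clusterSquare w a b c ≤ (prodBernoulli w).real (openConn b c)ᶜ * (prodBernoulli w).real (openConn a b ∩ openConn a c)ᶜ) :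
    (prodBernoulli w).real ((openConn a b)ᶜ ∩ (openConn a c)ᶜ ∩ (openConn b c)ᶜ) ^ 2 ≤
      (prodBernoulli w).real (openConn a b)ᶜ * (prodBernoulli w).real (openConn a c)ᶜ *
        (prodBernoulli w).real (openConn b c)ᶜ := by
  set μ := prodBernoulli w with hμ
  refine tripleSplit_of_mul_clusterSquare_le w a b c ?_
  have hD0 : (0 : ℝ) ≤ μ.real ((openConn a b)ᶜ ∩ (openConn a c)ᶜ) := measureReal_nonneg
  have hU0 : (0 : ℝ) ≤ μ.real (openConn b c)ᶜ := measureReal_nonneg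
  have hVeq : (openConn a b ∩ openConn a c : Set (BondConfig (Fin n)))ᶜ = (openConn a b)ᶜ ∪ (openConn a c)ᶜ := Set.compl_inter _ _
  have h2 := real_inter_mul_real_union_le n w (openConn a b)ᶜ (openConn a c)ᶜ
  calc μ.real ((openConn a b)ᶜ ∩ (openConn a c)ᶜ) * clusterSquare w a b c
      ≤ μ.real ((openConn a b)ᶜ ∩ (openConn a c)ᶜ) * (μ.real (openConn b c)ᶜ * μ.real (openConn a b ∩ openConn a c)ᶜ) :=
        mul_le_mul_of_nonneg_left h hD0
    _ = μ.real ((openConn a b)ᶜ ∩ (openConn a c)ᶜ) * μ.real ((openConn a b)ᶜ ∪ (openConn a c)ᶜ) * μ.real (openConn b c)ᶜ := by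
        rw [hVeq]; ring
    _ ≤ μ.real (openConn a b)ᶜ * μ.real (openConn a c)ᶜ * μ.real (openConn b c)ᶜ := mul_le_mul_of_nonneg_right h2 hU0

/-- **CSQ-V ⟹ TS.** [cite: Gladkov2024, Thm. 5.2 (pattern)] -/
theorem tripleSplit_of_clusterSquareSplitV (h : ClusterSquareSplitV) : TripleSplit := fun n w a b c =>
  tripleSplit_of_clusterSquare_le_mul_notAll w a b c (h n w a b c)

/-- **THE BUDGET FOR TS.**  For every finite weighted graph on `Fin n` and vertices `a, b, c`: if `T ≤ U² + Q` and the excess `Q` fits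
into the budget `D·(U² + Q) ≤ U_ab·U_ac·U` — equivalently `D·Q ≤ U·(BC + AD)` in pattern notation — then the triple-split inequality
holds for `{a, b, c}`: `μ(a|b|c)² ≤ μ(a↮b)·μ(a↮c)·μ(b↮c)`.  THE INTENDED `Q` is the quad-clash mass `P(E ∩ {quadruple clash})` of
`Consts.setIntegral_sepOff_sq_le_sq_add_quadClash` (supply `hQ` as that theorem after `unfold clusterSquare sepOffCluster`), for which
the budget inequality is the open target described in the file docstring; `Q = 0` is CSQ at `(a; b, c)`.
[cite: Gladkov2024, Thm. 5.2 and Thm. 4.3 (Cauchy–Schwarz over `C_a` + decision-tree vdBK)] -/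
theorem tripleSplit_of_clusterSquare_budget {n : ℕ} (w : Sym2 (Fin n) → unitInterval) (a b c : Fin n) (Q : ℝ)
    (hQ : clusterSquare w a b c ≤ (prodBernoulli w).real (openConn b c)ᶜ ^ 2 + Q)
    (h : (prodBernoulli w).real ((openConn a b)ᶜ ∩ (openConn a c)ᶜ) * ((prodBernoulli w).real (openConn b c)ᶜ ^ 2 + Q) ≤
      (prodBernoulli w).real (openConn a b)ᶜ * (prodBernoulli w).real (openConn a c)ᶜ * (prodBernoulli w).real (openConn b c)ᶜ) :
    (prodBernoulli w).real ((openConn a b)ᶜ ∩ (openConn a c)ᶜ ∩ (openConn b c)ᶜ) ^ 2 ≤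
      (prodBernoulli w).real (openConn a b)ᶜ * (prodBernoulli w).real (openConn a c)ᶜ *
        (prodBernoulli w).real (openConn b c)ᶜ :=
  tripleSplit_of_mul_clusterSquare_le w a b c ((mul_le_mul_of_nonneg_left hQ measureReal_nonneg).trans h)

/-- **The budget in excess form**: if `T ≤ U² + Q` and `D·Q ≤ U_ab·U_ac·U − D·U²` then TS.  (Here `U_ab·U_ac − D·U = μ(b|ac)·μ(c|ab) + μ(a|bc)·μ(D_a) ≥ 0`.) [cite: Gladkov2024, Thm. 5.2 (pattern)] -/
theorem tripleSplit_of_clusterSquare_budget' {n : ℕ} (w : Sym2 (Fin n) → unitInterval) (a b c : Fin n) (Q : ℝ)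
    (hQ : clusterSquare w a b c ≤ (prodBernoulli w).real (openConn b c)ᶜ ^ 2 + Q)
    (h : (prodBernoulli w).real ((openConn a b)ᶜ ∩ (openConn a c)ᶜ) * Q ≤
      (prodBernoulli w).real (openConn a b)ᶜ * (prodBernoulli w).real (openConn a c)ᶜ * (prodBernoulli w).real (openConn b c)ᶜ -
        (prodBernoulli w).real ((openConn a b)ᶜ ∩ (openConn a c)ᶜ) * (prodBernoulli w).real (openConn b c)ᶜ ^ 2) :
    (prodBernoulli w).real ((openConn a b)ᶜ ∩ (openConn a c)ᶜ ∩ (openConn b c)ᶜ) ^ 2 ≤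
      (prodBernoulli w).real (openConn a b)ᶜ * (prodBernoulli w).real (openConn a c)ᶜ *
        (prodBernoulli w).real (openConn b c)ᶜ :=
  tripleSplit_of_clusterSquare_budget w a b c Q hQ (by nlinarith [h])

end Consts

end Summit.CriticalPhenomena.PercolationContinuityZ3.Theorems
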